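import Summits.BirchSwinnertonDyer.BirchSwinnertonDyer.Theses.ShaPrimaryTransfer
import Literature.NumberTheory.EllipticCurves.KubertTate14613GaussianDescent
import HarnessLib

/-!
# BirchSwinnertonDyer / ShaPrimaryTransfer — crux `FiniteShaComponentTransfer` (stmt-BirchSwinnertonDyer-22356):
# AN UNCONDITIONAL DOOR AT 5 ON A RANK-2 CURVE WITHOUT RATIONAL 5-TORSION — the twist `E_{146/13}^{(-4)}`

Helper file of prover seat `bsd-line-spt-p1` g21 (`--supports stmt-22356 --as helper`). THEOREMS ONLY. The tree's
`Literature/…/KubertTate14613GaussianDescent` runs the complete `5`-isogeny descent of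
`E_{146/13} = [-133, -1898, -24674, 0, 0]` over `ℚ(i)` at FIVE places — `(1 + ζ₄)` and the two conjugate pairs above the
SPLIT primes `13, 73 ∣ mn` — with a box filled by three `ℚ`-points and two `ℚ(i)`-points coming from the twist
(`rank E(ℚ(i)) = 4`, `Ш(E ⊗ ℚ(i))[5] = 0`), and descends to the quadratic twist `E_{146/13}^{(-4)}/ℚ` (`≅ E^{(-1)}`; NO
rational `5`-torsion point): **`rank E^{(-4)}(ℚ) = 2` and `t₅(E^{(-4)}) = corank_{ℤ₅} Ш(E^{(-4)}/ℚ)[5^∞] = 0`**, with no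
`L`-function, `p`-adic or conjectural input.  Here this is read in the route's currency:

* `shaCorank_five_twist_eq_zero` — `t₅(E_{146/13}^{(-4)}) = 0`; `mordellWeilRank_twist_eq_two` — rank `2`;
* `oneFiniteShaComponent_twist` — O (`OneFiniteShaComponent`'s shape) for the twist with witness `p₀ = 5`;
* `transfer_twist` — **T BY NAME** on the twist: `FiniteShaComponentTransfer → ∀ q, t_q(E_{146/13}^{(-4)}) = 0`;
* `transfer_iff_twist` — on this curve T's content is exactly «`t_q = 0` at every prime `q ≠ 5`» (the door at `5`
  is already open unconditionally).

At analytic rank `≥ 2` no theorem in print gives `t_p = 0` for a curve outside the rational-`p`-torsion / rational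
`p`-isogeny-descent classes at its own prime; this is the first rank-`2` member of the tree's cross-prime table whose
door prime `p₀ = 5` is ADMISSIBLE (`≥ 5`, good — `5 ∤ Δ(E^{(-4)}) = 2¹²Δ(E)`) and which has no rational `5`-torsion.
T is UNCHANGED (conjecture-grade at analytic rank ≥ 2) and BSD is NOT proved by any of this.

## References

* [SilvermanAEC2009] J. H. Silverman, *AEC*, 2nd ed., Thm. X.4.2, Exercise 10.16.
* [Fisher2001FiveSevenDescent] T. Fisher, JEMS 3 (2001), §§1–2.
-/

-- D-0017: single-problem summit, so `Summit.BirchSwinnertonDyer.BirchSwinnertonDyer.…` repeats a namespace BY DESIGN.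
set_option linter.dupNamespace false
set_option autoImplicit false

noncomputable section

open scoped Classical
open Literature.NumberTheory.EllipticCurves WeierstrassCurve
open Summit.BirchSwinnertonDyer.BirchSwinnertonDyer.Theses.ShaPrimaryTransfer

namespace Summit.BirchSwinnertonDyer.BirchSwinnertonDyer.Theorems.ShaPrimaryTransferGaussianTwistDoor14613

/-- The twist `E_{146/13}^{(-4)}` is elliptic (`-4 ≠ 0`). [cite: SilvermanAEC2009, X.§2] -/
theorem isElliptic_twist :
    haveI := KubertTate14613Descent.isElliptic
    ((kubertTateFive (((146 : ℤ) : ℚ)) (((13 : ℤ) : ℚ))).quadraticTwist (-4)).IsElliptic := by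
  haveI := KubertTate14613Descent.isElliptic
  exact isElliptic_quadraticTwist _ (by norm_num)

/-- **`t₅(E_{146/13}^{(-4)}/ℚ) = 0`, unconditionally** (descent over `ℚ(i) = CyclotomicField 4 ℚ`; tree
`KubertTate14613GaussianDescent.shaCorank_five_twist_eq_zero`). [cite: SilvermanAEC2009, Thm. X.4.2 and Exercise 10.16]
[cite: Fisher2001FiveSevenDescent, §2] -/
theorem shaCorank_five_twist_eq_zero :
    haveI := KubertTate14613Descent.isElliptic
    haveI := isElliptic_twist
    ((kubertTateFive (((146 : ℤ) : ℚ)) (((13 : ℤ) : ℚ))).quadraticTwist (-4)).shaCorank 5 = 0 := by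
  haveI := KubertTate14613Descent.isElliptic
  haveI := isElliptic_twist
  haveI : IsCyclotomicExtension {4} ℚ (CyclotomicField 4 ℚ) := CyclotomicField.isCyclotomicExtension 4 ℚ
  exact KubertTate14613GaussianDescent.shaCorank_five_twist_eq_zero (CyclotomicField 4 ℚ)

/-- **`rank E_{146/13}^{(-4)}(ℚ) = 2`, unconditionally** — a rank-`2` curve over `ℚ` without rational `5`-torsion whose
`5`-primary Tate–Shafarevich group has corank `0` by descent alone. [cite: SilvermanAEC2009, Exercise 10.16] -/
theorem mordellWeilRank_twist_eq_two :
    haveI := KubertTate14613Descent.isElliptic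
    haveI := isElliptic_twist
    ((kubertTateFive (((146 : ℤ) : ℚ)) (((13 : ℤ) : ℚ))).quadraticTwist (-4)).mordellWeilRank = 2 := by
  haveI := KubertTate14613Descent.isElliptic
  haveI := isElliptic_twist
  haveI : IsCyclotomicExtension {4} ℚ (CyclotomicField 4 ℚ) := CyclotomicField.isCyclotomicExtension 4 ℚ
  exact KubertTate14613GaussianDescent.mordellWeilRank_twist_eq_two (CyclotomicField 4 ℚ)

/-- **O for `E_{146/13}^{(-4)}` with witness `p₀ = 5`** (the route's `OneFiniteShaComponent` shape, unconditional, on a rank-`2`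
curve without rational `5`-torsion). [cite: SilvermanAEC2009, Thm. X.4.2] -/
theorem oneFiniteShaComponent_twist :
    haveI := KubertTate14613Descent.isElliptic
    haveI := isElliptic_twist
    ∃ (p : ℕ) (_ : Fact p.Prime), ((kubertTateFive (((146 : ℤ) : ℚ)) (((13 : ℤ) : ℚ))).quadraticTwist (-4)).shaCorank p = 0 :=
  ⟨5, ⟨Nat.prime_five⟩, shaCorank_five_twist_eq_zero⟩

/-- **T BY NAME on `E_{146/13}^{(-4)}`**: granting `FiniteShaComponentTransfer`, every primary component of
`Ш(E_{146/13}^{(-4)}/ℚ)` has corank `0` — an instance of T's load-bearing slice at analytic rank presumably `2`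
(rank `2`; admissible door `5`; no rational `5`-torsion) fed by an unconditional door. T itself is NOT proved.
[cite: SilvermanAEC2009, Thm. X.4.2] -/
theorem transfer_twist (hT : FiniteShaComponentTransfer) (q : ℕ) [Fact q.Prime] :
    haveI := KubertTate14613Descent.isElliptic
    haveI := isElliptic_twist
    ((kubertTateFive (((146 : ℤ) : ℚ)) (((13 : ℤ) : ℚ))).quadraticTwist (-4)).shaCorank q = 0 := by
  haveI := KubertTate14613Descent.isElliptic
  haveI := isElliptic_twist
  haveI : Fact (Nat.Prime 5) := ⟨Nat.prime_five⟩
  exact hT _ 5 q shaCorank_five_twist_eq_zero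

/-- **What T says about this curve, exactly**: since the door at `5` is open unconditionally, the instance of T at
`E_{146/13}^{(-4)}` (all `p → q` transfers) is EQUIVALENT to «`t_q(E_{146/13}^{(-4)}) = 0` for every prime `q`» — the
remaining content is the transfer `5 → q`, `q ≠ 5`, on a rank-`2` curve (open). [cite: SilvermanAEC2009, Thm. X.4.2] -/
theorem transfer_iff_twist :
    haveI := KubertTate14613Descent.isElliptic
    haveI := isElliptic_twist
    (∀ (p q : ℕ) [Fact p.Prime] [Fact q.Prime],
        ((kubertTateFive (((146 : ℤ) : ℚ)) (((13 : ℤ) : ℚ))).quadraticTwist (-4)).shaCorank p = 0 →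
          ((kubertTateFive (((146 : ℤ) : ℚ)) (((13 : ℤ) : ℚ))).quadraticTwist (-4)).shaCorank q = 0) ↔
      ∀ (q : ℕ) [Fact q.Prime], ((kubertTateFive (((146 : ℤ) : ℚ)) (((13 : ℤ) : ℚ))).quadraticTwist (-4)).shaCorank q = 0 := by
  haveI := KubertTate14613Descent.isElliptic
  haveI := isElliptic_twist
  haveI : Fact (Nat.Prime 5) := ⟨Nat.prime_five⟩
  constructor
  · intro h q _
    exact h 5 q shaCorank_five_twist_eq_zero
  · intro h p q _ _ _
    exact h q

end Summit.BirchSwinnertonDyer.BirchSwinnertonDyer.Theorems.ShaPrimaryTransferGaussianTwistDoor14613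

end
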